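import Mathlib
import Summits.ResolutionOfSingularities.ResolutionOfSingularities.Theorems.SandwichedSingularitiesResolution
import Literature.AlgebraicGeometry.Resolution.LocalRegLeificationOfSandwiched
import Literature.AlgebraicGeometry.Resolution.ProperModelsModification
import HarnessLib

/-!
# ResolutionOfSingularities / Valuative — crux `PatchingRel`, line `sandwiched-gluing`, stub S2ᴸ:
# RegLe-ification of proper models from SANDᴸ, directly

Crux `stmt-ResolutionOfSingularities-0642` (`Valuative.PatchingRel` = `CyclicCovers.PatchingRel`),
line `sandwiched-gluing`, gen-1 cut. Registered stub
`stub_regLeification_of_sandwichedLocus : ∀ p, SandwichedLocusResolution.{0} p →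
ProperModel.RegLeification.{0} p`, proved outright and universe-polymorphically
(`regLeification_of_sandwichedLocusResolution`): for `φ : M → Y` a morphism of proper models of
`K/k` (`char k = p`), SANDᴸ(p) applied to `M` with `O := φ⁻¹(Reg Y) ∪ Reg M`, `V := φ⁻¹(Reg Y)`,
`U := Reg Y` yields an integral `N` and a proper birational `ρ : N → M` regular over `O`;
`(N, ρ)` is a proper model dominating `M` (`ProperModel.exists_properModel_of_isBirational`) and
"regular over `O`" is `ρ⁻¹(Reg M) ⊆ Reg N ∧ (φρ)⁻¹(Reg Y) ⊆ Reg N`. With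
`SandwichedGluing.twoModelPatching_of_regLeification` and the resolving system
(`stub_resolutionInChar_of_properPatching`) this closes the crux modulo SANDᴸ alone — no gluing,
no Nagata compactification (`Theorems/ValuativePatchingRel.lean`, `patchingRel_of_sandwichedLocus`).

## References

* O. Piltant, *An axiomatic version of Zariski's patching theorem*, RACSAM 107 (2013) 91–121,
  proof of Prop. 5.1. [Piltant2013]
-/

-- `Summit.<Summit>.<Sub>[.Theorems]` with `Sub = Summit` (single-conjunct summit, D-0017): the duplicated
-- namespace component is the tree layout.
set_option linter.dupNamespace false

noncomputable section

namespace Summit.ResolutionOfSingularities.ResolutionOfSingularities.Theorems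

open CategoryTheory AlgebraicGeometry TopologicalSpace Topology
open Literature.AlgebraicGeometry.Resolution Literature.AlgebraicGeometry.Morphisms

universe u

/-- **SANDᴸ(p) ⇒ RegLe-ification of proper models in characteristic `p`**, directly: for a
morphism `φ : M → Y` of proper models of `K/k` (`char k = p`), SANDᴸ(p) applied to `M` with
`O := φ⁻¹(Reg Y) ∪ Reg M`, `V := φ⁻¹(Reg Y)`, `U := Reg Y` gives an integral `N` and a proper
birational `ρ : N → M` regular over `O`; `(N, ρ)` is a proper model dominating `M`
(`ProperModel.exists_properModel_of_isBirational`), and "regular over `O`" is literally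
`ρ⁻¹(Reg M) ⊆ Reg N` and `(φρ)⁻¹(Reg Y) ⊆ Reg N`. No gluing, no compactification.
[folklore] -/
theorem regLeification_of_sandwichedLocusResolution (p : ℕ)
    (hS : SandwichedLocusResolution.{u} p) : ProperModel.RegLeification.{u} p := by
  intro k _ _ K _ _ _ M Y φ
  let UY : Y.X.Opens :=
    ⟨Scheme.regularLocus Y.X, isOpen_regularLocus_of_locallyOfFiniteType_field Y.π⟩
  let RM : M.X.Opens :=
    ⟨Scheme.regularLocus M.X, isOpen_regularLocus_of_locallyOfFiniteType_field M.π⟩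
  let V : M.X.Opens := φ.f ⁻¹ᵁ UY
  let O : M.X.Opens := V ⊔ RM
  have hVO : V ≤ O := le_sup_left
  have hgenY : genericPoint Y.X ∈ UY := by
    show genericPoint Y.X ∈ Scheme.regularLocus Y.X
    apply Scheme.genericPoints_subset_regularLocus
    rw [genericPoints_eq_singleton]
    rfl
  haveI : Nonempty (UY : Scheme.{u}) := ⟨⟨_, hgenY⟩⟩
  haveI : IsIntegral (UY : Scheme.{u}) := isIntegral_of_isOpenImmersion UY.ι
  have hUreg : Scheme.IsRegular (UY : Scheme.{u}) := fun u =>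
    (isRegularLocalRing_stalk_iff_of_isOpenImmersion UY.ι u).mp u.2
  have hcompat : (φ.f ∣_ UY) ≫ (UY.ι ≫ Y.π) = V.ι ≫ M.π := by
    rw [morphismRestrict_ι_assoc, φ.f_π]
  have hout : ∀ x : M.X, x ∈ O → x ∉ V → IsRegularLocalRing (M.X.presheaf.stalk x) := by
    intro x hx hxV
    rcases Opens.mem_sup.mp hx with h | h
    · exact absurd h hxV
    · exact h
  -- SANDᴸ: a proper birational integral `N → M` regular over `O`
  obtain ⟨N, ρ, hN, hρ, hbir, hreg⟩ := hS k (UY : Scheme.{u}) M.X (UY.ι ≫ Y.π) M.π O V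
    (φ.f ∣_ UY) inferInstance inferInstance inferInstance inferInstance hUreg inferInstance
    inferInstance inferInstance inferInstance inferInstance (φ.isBirational.morphismRestrict UY)
    hcompat hVO hout
  haveI := hN
  haveI := hρ
  -- `(N, ρ)` is a proper model dominating `M`
  obtain ⟨M', ψ, e, hψ⟩ := M.exists_properModel_of_isBirational ρ hbir
  subst e
  rw [eqToHom_refl, Category.id_comp] at hψ
  refine ⟨M', ψ, fun y hy => hreg y ?_, fun y hy => hreg y ?_⟩
  · rw [hψ] at hy
    exact Opens.mem_sup.mpr (Or.inr hy)
  · rw [ProperModel.Hom.comp_f, Scheme.Hom.comp_apply, hψ] at hy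
    exact hVO (show φ.f (ρ y) ∈ UY from hy)

/-- **Registered stub S2ᴸ of line `sandwiched-gluing`** (universe `0`): SANDᴸ(p) gives
RegLe-ification of morphisms of proper models in characteristic `p`. [folklore] -/
theorem stub_regLeification_of_sandwichedLocus :
    ∀ p : ℕ, SandwichedLocusResolution.{0} p → ProperModel.RegLeification.{0} p :=
  fun p h => regLeification_of_sandwichedLocusResolution p h

end Summit.ResolutionOfSingularities.ResolutionOfSingularities.Theorems


end
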